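import Literature.NumberTheory.Automorphic.SatakeTransformDuality
import Literature.NumberTheory.Automorphic.HyperspecialUnitaryHeckeTriangularProducts
import HarnessLib

/-!
# The `w₀`-symmetry of the Satake transforms of the unramified unitary group `U(σ, J₀)`: the coefficient of `x^μ` is the
# modulus `δ(μ)` times the coefficient of `x^{-μ}`, for EVERY element of the spherical Hecke algebra (Cartier Thm. 4.1 for
# `w₀ = -1 ∈ W`; Laumon (4.1.4)–(4.1.6); Mínguez §4)

Topic `NumberTheory/Automorphic`; namespace `Literature.NumberTheory.Automorphic.HermitianLattice.UnramifiedLocalConjDatum`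
(lane `lit-hodgefound`, Track 2 foundations;
seat `lit-hodgefound-p11`, generation 44, row g44-#3).  THEOREMS ONLY: no definition, no named fact, no instance, no notation.
The `U(σ, J₀)` instance of the abstract duality `SatakeTransformDuality` (g44-#1).

## The mathematics

`G = U(σ, J₀) ≤ GL_N(K)` the quasi-split unitary group of the antidiagonal Hermitian form over a field `K` with `Valued K ℤᵐ⁰`
and an unramified conjugation datum `hd : UnramifiedLocalConjDatum σ ϖ`, `K₀ = G ∩ GL_N(𝒪)` hyperspecial, `P = {u · diag(ϖ^a)}`
(`a ∘ rev = -a`), `a = hd.iwasawaExp`, `K_P = P ∩ K₀ = ` the integral unitriangular elements of `G`.  Two inputs: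

1. **Relative unimodularity** (§1): the torus element `t₀ = diag(ϖ^{λ₀})`, `λ₀ i = N - 1 - 2i` (strictly decreasing,
   antisymmetric), contracts `K_P` (`t₀ K_P t₀⁻¹ ≤ K_P`) and conjugates every unitriangular `u ∈ G` into `K₀` after finitely
   many steps (entry `(i, j)` of `t₀ᵏ u t₀⁻ᵏ` is `ϖ^{2k(j-i)} u_{ij}`); so `P ∩ a⁻¹(0)` is the union of the compact open subgroups
   `t₀⁻ᵏ K_P t₀ᵏ ⊇ K_P` and g44-#1 applies (`exists_subgroup_relIndex_ne_zero_unitary`).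
2. **Every double coset is self-inverse** (§2): `K₀ g⁻¹ K₀ = K₀ g K₀` (`-1 ∈ W`: the Cartan representative `diag(ϖ^c)` of
   `g` has `diag(ϖ^c)⁻¹ = P_rev diag(ϖ^c) P_rev⁻¹`, tree: `inv_zpowDiagGL_mem_orbit_unitary`,
   `exists_zpowDiagGL_monotone_mem_orbit_unitary`), hence `T_{g⁻¹} = T_g` in `ℋ(G, K₀; R)` (`doubleCosetOperator_inv_unitary`).

Consequently (§3), for every commutative ring `R`, every `T ∈ ℋ(G, K₀; R)`, every antisymmetric `μ : Fin N → ℤ` and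
`t_μ = diag(ϖ^μ)`:

  `𝒮_1(T)_μ · [t_μK_Pt_μ⁻¹ : K_P ∩ t_μK_Pt_μ⁻¹] = 𝒮_1(T)_{-μ} · [K_P : K_P ∩ t_μK_Pt_μ⁻¹]`   (`coeff_satakeTransform_one_mul_relIndex_eq_unitary`),

and for `μ` dominant (antitone) the first index is `1`: **`𝒮_1(T)_μ = [K_P : t_μ K_P t_μ⁻¹] · 𝒮_1(T)_{-μ}`** — the counting
transform of every Hecke operator is symmetric under `w₀ = -1` up to the modulus character `δ(μ) = [K_P : t_μK_Pt_μ⁻¹]`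
(`coeff_satakeTransform_one_eq_relIndex_mul_of_antitone_unitary`); with weights absorbing `δ` (`δ^{-1/2}` when available in `R`)
the transform is literally `ι`-invariant, `ι(x^μ) = x^{-μ}` (`satakeTransform_eq_domCongr_neg_unitary`).  This is the
`w₀`-part of «the Satake transform is an isomorphism onto `ℂ[Λ]^W`» (Cartier Thm. 4.1) for `U(σ, J₀)`, over any `R`, with the
modulus kept as an index (its closed form `q^{⟨2ρ, μ⟩}` is not needed); in relative rank one (`N = 2, 3`: `W = {1, w₀}`) it is
the whole `W`-invariance.

## What is formalised (theorems only)

* §1 `exists_v_uniformizer_pow_mul_le_one` (`_forall`), `coe_conj_zpowDiagGL_apply_unitary`, `blockTriangular_coe_of_mem_borelLatticeU`,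
  `conj_mem_unitaryInt_of_antitone`, `zpowDiagGL_mem_borelLatticeU`, **`conjAct_smul_inf_le_of_antitone_unitary`** (dominant
  torus elements contract `K_P`), `coe_mem_upperUnitriangular_of_iwasawaExp_eq_zero` (`P ∩ a⁻¹(0) = ` unitriangular),
  `coe_zpowDiagGL_pow_unitary`, `antitone_sub_two_mul`, `sub_two_mul_rev`, **`exists_conj_pow_mem_unitaryInt`**,
  **`exists_subgroup_relIndex_ne_zero_unitary`** (the relative unimodularity hypothesis of g44-#1 for `U(σ, J₀)`).
* §2 `orbit_inv_eq_orbit_unitary`, **`doubleCosetOperator_inv_unitary`** (`T_{g⁻¹} = T_g` for all `g`).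
* §3 **`card_filter_iwasawaExp_mul_relIndex_eq_unitary`**, **`coeff_satakeTransform_one_mul_relIndex_eq_unitary`**,
  **`coeff_satakeTransform_one_eq_relIndex_mul_of_antitone_unitary`**, `coeff_satakeTransform_mul_relIndex_eq_unitary`
  (weight `w`), **`satakeTransform_eq_domCongr_neg_unitary`**, `domCongr_neg_satakeTransform_eq_self_unitary`,
  `inf_le_conjAct_smul_of_monotone_unitary` (antidominant `t_c` EXPAND `K_P`),
  **`card_filter_iwasawaExp_orbit_neg_eq_relIndex_unitary`** (the dominant-extreme count
  `#{γ ∈ K₀t_cK₀/K₀ : a γ = -c} = [t_cK_Pt_c⁻¹ : K_P]`, from the tree's `#{γ : a γ = c} = 1`).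

## References
* [CartierCorvallis1979] P. Cartier, *Representations of 𝔭-adic groups: a survey*, PSPM 33.1 (1979), §I.3, §IV (4.2), Thm. 4.1.
* [Laumon1995] G. Laumon, *Cohomology of Drinfeld Modular Varieties I*, CUP, (4.1.4)–(4.1.6).
* [Minguez2011] A. Mínguez, *Unramified representations of unitary groups*, in: *On the stabilization of the trace formula*
  (2011), §4 (unramified Hecke algebra and Satake isomorphism of `U(n)`).
* [BruhatTits1972] F. Bruhat, J. Tits, *Groupes réductifs sur un corps local I*, Publ. Math. IHÉS 41 (1972), (4.4.3), (4.4.4).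
* [Tits1979] J. Tits, *Reductive groups over local fields*, PSPM 33.1 (1979), §3.3.3.
-/

noncomputable section

open scoped Valued WithZero Matrix MatrixGroups Pointwise
open MonoidAlgebra Representation Finset MulAction ConjAct

namespace Literature.NumberTheory.Automorphic.HermitianLattice

open Literature.NumberTheory.Automorphic.CartanUnique Literature.NumberTheory.Automorphic.SymplecticCartan

variable {K : Type*} [Field K] [Valued K ℤᵐ⁰] {σ : K →+* K} {ϖ : K} {N : ℕ}

/-! ## §1 Relative unimodularity of the unipotent radical of `U(σ, J₀)` -/

/-- Every `x ∈ K` becomes integral after multiplication by a power of the uniformiser. [cite: CartierCorvallis1979, §IV (4.2)] -/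
theorem exists_v_uniformizer_pow_mul_le_one (hϖ : Valued.v ϖ = WithZero.exp (-1 : ℤ)) (x : K) :
    ∃ k : ℕ, ∀ j : ℕ, k ≤ j → Valued.v (ϖ ^ j * x) ≤ 1 := by
  by_cases hx : x = 0
  · exact ⟨0, fun j _ => by rw [hx, mul_zero, map_zero]; exact zero_le⟩
  have hvx : Valued.v x ≠ 0 := (Valuation.ne_zero_iff _).2 hx
  refine ⟨(WithZero.log (Valued.v x)).toNat, fun j hj => ?_⟩
  rw [map_mul, v_uniformizer_pow hϖ, ← WithZero.exp_log hvx, ← WithZero.exp_add, ← WithZero.exp_zero, WithZero.exp_le_exp]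
  have := Int.self_le_toNat (WithZero.log (Valued.v x))
  omega

/-- Finitely many elements become integral after multiplication by one common power of `ϖ`. [cite: CartierCorvallis1979, §IV (4.2)] -/
theorem exists_v_uniformizer_pow_mul_le_one_forall (hϖ : Valued.v ϖ = WithZero.exp (-1 : ℤ)) {ι : Type*} [Finite ι]
    (x : ι → K) : ∃ k : ℕ, ∀ i, ∀ j : ℕ, k ≤ j → Valued.v (ϖ ^ j * x i) ≤ 1 := by
  classical
  haveI := Fintype.ofFinite ι
  choose k hk using fun i => exists_v_uniformizer_pow_mul_le_one hϖ (x i)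
  exact ⟨Finset.univ.sup k, fun i j hj => hk i j ((Finset.le_sup (Finset.mem_univ i)).trans hj)⟩

omit [Valued K ℤᵐ⁰] in
/-- Entries of a conjugate by a torus element: `(diag(ϖ^lam) x diag(ϖ^lam)⁻¹)_{ij} = ϖ^{lam_i - lam_j} x_{ij}`.
[cite: BruhatTits1972, (4.4.4) (ii)] -/
theorem coe_conj_zpowDiagGL_apply_unitary {hϖ0 : ϖ ≠ 0} (lam : Fin N → ℤ) (x : GL (Fin N) K) (i j : Fin N) :
    ((zpowDiagGL hϖ0 lam * x * (zpowDiagGL hϖ0 lam)⁻¹ : GL (Fin N) K) : Matrix (Fin N) (Fin N) K) i j =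
      ϖ ^ (lam i - lam j) * (x : Matrix (Fin N) (Fin N) K) i j := by
  have h := coe_zpowDiagGL_inv_mul_mul_zpowDiagGL_apply hϖ0 (-lam) x i j
  rwa [zpowDiagGL_neg, inv_inv, Pi.neg_apply, Pi.neg_apply, sub_neg_eq_add, neg_add_eq_sub] at h

namespace UnramifiedLocalConjDatum

/-- Elements of `P = {u · diag(ϖ^a)}` are upper triangular. [cite: BruhatTits1972, (4.4.3)] -/
theorem blockTriangular_coe_of_mem_borelLatticeU (hd : UnramifiedLocalConjDatum σ ϖ)
    {x : unitaryGroupOfForm σ ((StdForm.antidiagonal N).over K)} (hx : x ∈ hd.borelLatticeU) :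
    ((x : GL (Fin N) K) : Matrix (Fin N) (Fin N) K).BlockTriangular id := by
  obtain ⟨u, t, hu, ⟨b, -, ht⟩, rfl⟩ := hx
  rw [Subgroup.coe_mul, Units.val_mul, ht]
  exact (blockTriangular_of_mem_upperUnitriangular hu).mul (blockTriangular_zpowDiagGL _ b)

/-- **Conjugation by `diag(ϖ^lam)`, `lam` antitone, keeps an upper triangular element of `K₀` in `K₀`** (entry `(i, j)`,
`i ≤ j`, is multiplied by `ϖ^{lam_i - lam_j}`, of valuation `≤ 1`). [cite: BruhatTits1972, (4.4.4) (ii)] -/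
theorem conj_mem_unitaryInt_of_antitone (hd : UnramifiedLocalConjDatum σ ϖ) {lam : Fin N → ℤ} (hlam : Antitone lam)
    (hlam' : ∀ i, lam (Fin.rev i) = -lam i) {x : unitaryGroupOfForm σ ((StdForm.antidiagonal N).over K)}
    (hxP : x ∈ hd.borelLatticeU) (hxK : x ∈ unitaryInt σ ((StdForm.antidiagonal N).over K)) :
    (⟨zpowDiagGL (uniformizer_ne_zero hd.vϖ) lam, zpowDiagGL_mem_unitaryGroupOfForm hd.σϖ _ hlam'⟩ :
        unitaryGroupOfForm σ ((StdForm.antidiagonal N).over K)) * x *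
      (⟨zpowDiagGL (uniformizer_ne_zero hd.vϖ) lam, zpowDiagGL_mem_unitaryGroupOfForm hd.σϖ _ hlam'⟩ :
        unitaryGroupOfForm σ ((StdForm.antidiagonal N).over K))⁻¹ ∈ unitaryInt σ ((StdForm.antidiagonal N).over K) := by
  have hϖ0 := uniformizer_ne_zero hd.vϖ
  -- the estimate for an upper triangular integral matrix
  have key : ∀ y : GL (Fin N) K, (y : Matrix (Fin N) (Fin N) K).BlockTriangular id →
      (∀ i j, Valued.v ((y : Matrix (Fin N) (Fin N) K) i j) ≤ 1) →
      ∀ i j, Valued.v (((zpowDiagGL hϖ0 lam * y * (zpowDiagGL hϖ0 lam)⁻¹ : GL (Fin N) K) : Matrix (Fin N) (Fin N) K) i j) ≤ 1 := by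
    intro y hyT hyO i j
    rw [coe_conj_zpowDiagGL_apply_unitary]
    rcases lt_or_ge j i with hji | hij
    · rw [hyT hji, mul_zero, map_zero]; exact zero_le
    · rw [map_mul, v_uniformizer_zpow hd.vϖ, ← one_mul (1 : ℤᵐ⁰)]
      refine mul_le_mul' ?_ (hyO i j)
      rw [← WithZero.exp_zero, WithZero.exp_le_exp, neg_nonpos, sub_nonneg]
      exact hlam hij
  rw [mem_unitaryInt_iff] at hxK ⊢
  refine ⟨fun i j => ?_, fun i j => ?_⟩
  · rw [Subgroup.coe_mul, Subgroup.coe_mul, Subgroup.coe_inv]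
    exact key _ (hd.blockTriangular_coe_of_mem_borelLatticeU hxP) hxK.1 i j
  · have e : (((⟨zpowDiagGL hϖ0 lam, zpowDiagGL_mem_unitaryGroupOfForm hd.σϖ _ hlam'⟩ :
          unitaryGroupOfForm σ ((StdForm.antidiagonal N).over K)) * x *
        (⟨zpowDiagGL hϖ0 lam, zpowDiagGL_mem_unitaryGroupOfForm hd.σϖ _ hlam'⟩ :
          unitaryGroupOfForm σ ((StdForm.antidiagonal N).over K))⁻¹ :
          unitaryGroupOfForm σ ((StdForm.antidiagonal N).over K)) : GL (Fin N) K)⁻¹ =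
        zpowDiagGL hϖ0 lam * ((x⁻¹ : unitaryGroupOfForm σ ((StdForm.antidiagonal N).over K)) : GL (Fin N) K) *
          (zpowDiagGL hϖ0 lam)⁻¹ := by
      rw [Subgroup.coe_mul, Subgroup.coe_mul, Subgroup.coe_inv, Subgroup.coe_inv]
      group
    rw [e]
    refine key _ (hd.blockTriangular_coe_of_mem_borelLatticeU (hd.borelLatticeU.inv_mem hxP)) (fun i j => ?_) i j
    rw [Subgroup.coe_inv]
    exact hxK.2 i j

/-- `diag(ϖ^μ) ∈ P` for `μ` antisymmetric. [cite: BruhatTits1972, (4.4.3)] -/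
theorem zpowDiagGL_mem_borelLatticeU (hd : UnramifiedLocalConjDatum σ ϖ) {μ : Fin N → ℤ} (hμ : ∀ i, μ (Fin.rev i) = -μ i) :
    (⟨zpowDiagGL (uniformizer_ne_zero hd.vϖ) μ, zpowDiagGL_mem_unitaryGroupOfForm hd.σϖ _ hμ⟩ :
        unitaryGroupOfForm σ ((StdForm.antidiagonal N).over K)) ∈ hd.borelLatticeU := by
  have h1 := hd.unipotent_mul_torus_mem_borelLatticeU (u := 1)
    (t := (⟨zpowDiagGL (uniformizer_ne_zero hd.vϖ) μ, zpowDiagGL_mem_unitaryGroupOfForm hd.σϖ _ hμ⟩ :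
        unitaryGroupOfForm σ ((StdForm.antidiagonal N).over K)))
    (by rw [OneMemClass.coe_one]; exact (upperUnitriangular (Fin N) K).one_mem) hμ rfl
  rwa [one_mul] at h1

/-- **`diag(ϖ^lam) K_P diag(ϖ^lam)⁻¹ ≤ K_P` for `lam` antitone antisymmetric** (`K_P = P ∩ K₀`): dominant torus elements
contract. [cite: CartierCorvallis1979, §IV (4.2)] -/
theorem conjAct_smul_inf_le_of_antitone_unitary (hd : UnramifiedLocalConjDatum σ ϖ) {lam : Fin N → ℤ} (hlam : Antitone lam)
    (hlam' : ∀ i, lam (Fin.rev i) = -lam i) :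
    toConjAct (⟨zpowDiagGL (uniformizer_ne_zero hd.vϖ) lam, zpowDiagGL_mem_unitaryGroupOfForm hd.σϖ _ hlam'⟩ :
        unitaryGroupOfForm σ ((StdForm.antidiagonal N).over K)) •
        (hd.borelLatticeU ⊓ unitaryInt σ ((StdForm.antidiagonal N).over K)) ≤
      hd.borelLatticeU ⊓ unitaryInt σ ((StdForm.antidiagonal N).over K) := by
  set t : unitaryGroupOfForm σ ((StdForm.antidiagonal N).over K) :=
    ⟨zpowDiagGL (uniformizer_ne_zero hd.vϖ) lam, zpowDiagGL_mem_unitaryGroupOfForm hd.σϖ _ hlam'⟩ with ht_def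
  have htP : t ∈ hd.borelLatticeU := hd.zpowDiagGL_mem_borelLatticeU hlam'
  intro y hy
  rw [Subgroup.mem_pointwise_smul_iff_inv_smul_mem, ← toConjAct_inv, toConjAct_inv_smul] at hy
  obtain ⟨hyP, hyK⟩ := Subgroup.mem_inf.1 hy
  have e : y = t * (t⁻¹ * y * t) * t⁻¹ := by group
  refine Subgroup.mem_inf.2 ⟨?_, ?_⟩
  · rw [e]
    exact hd.borelLatticeU.mul_mem (hd.borelLatticeU.mul_mem htP hyP) (hd.borelLatticeU.inv_mem htP)
  · rw [e]
    exact hd.conj_mem_unitaryInt_of_antitone hlam hlam' hyP hyK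

/-- **`P ∩ a⁻¹(0) = ` the unitriangular elements**: `x ∈ P` with `a x = 0` is upper unitriangular.
[cite: BruhatTits1972, (4.4.3)] -/
theorem coe_mem_upperUnitriangular_of_iwasawaExp_eq_zero (hd : UnramifiedLocalConjDatum σ ϖ)
    {x : unitaryGroupOfForm σ ((StdForm.antidiagonal N).over K)} (hx : x ∈ hd.borelLatticeU) (hax : hd.iwasawaExp x = 0) :
    (x : GL (Fin N) K) ∈ upperUnitriangular (Fin N) K := by
  obtain ⟨u, t, hu, ⟨b, hb, ht⟩, rfl⟩ := hx
  rw [hd.iwasawaExp_unipotent_mul_torus hu ht] at hax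
  rw [hax, zpowDiagGL_zero] at ht
  rw [Subgroup.coe_mul, ht, mul_one]
  exact hu

omit [Valued K ℤᵐ⁰] in
/-- Powers of a torus element: `(diag(ϖ^lam))^k = diag(ϖ^{k lam})` as matrices. [cite: BruhatTits1972, (4.4.3)] -/
theorem coe_zpowDiagGL_pow_unitary {hϖ0 : ϖ ≠ 0} (lam : Fin N → ℤ) (k : ℕ) :
    (zpowDiagGL hϖ0 lam : GL (Fin N) K) ^ k = zpowDiagGL hϖ0 ((k : ℤ) • lam) := by
  induction k with
  | zero => rw [pow_zero, Nat.cast_zero, zero_smul, zpowDiagGL_zero]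
  | succ k ih => rw [pow_succ, ih, ← zpowDiagGL_add, Nat.cast_succ, add_smul, one_smul]

omit [Valued K ℤᵐ⁰] in
/-- The exponents of `t₀ = diag(ϖ^{N-1-2i})` are antitone … [cite: BruhatTits1972, (4.4.3)] -/
theorem antitone_sub_two_mul : Antitone (fun i : Fin N => (N : ℤ) - 1 - 2 * (i : ℕ)) := by
  intro i j hij
  have : (i : ℕ) ≤ (j : ℕ) := hij
  simp only
  omega

omit [Valued K ℤᵐ⁰] in
/-- … and antisymmetric under `rev`. [cite: BruhatTits1972, (4.4.3)] -/
theorem sub_two_mul_rev (i : Fin N) :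
    (fun i : Fin N => (N : ℤ) - 1 - 2 * (i : ℕ)) (Fin.rev i) = -(fun i : Fin N => (N : ℤ) - 1 - 2 * (i : ℕ)) i := by
  have h := Fin.val_rev i
  have hi := i.2
  simp only
  push_cast [h, Nat.cast_sub (show (i : ℕ) + 1 ≤ N by omega)]
  ring

/-- **Every unitriangular `u ∈ U(σ, J₀)` is conjugated into `K₀` by a power of `t₀ = diag(ϖ^{N-1-2i})`**: the entry
`(i, j)`, `i < j`, of `t₀ᵏ u t₀⁻ᵏ` is `ϖ^{2k(j-i)} u_{ij}`. [cite: CartierCorvallis1979, §IV (4.2)] -/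
theorem exists_conj_pow_mem_unitaryInt (hd : UnramifiedLocalConjDatum σ ϖ)
    {u : unitaryGroupOfForm σ ((StdForm.antidiagonal N).over K)} (hu : (u : GL (Fin N) K) ∈ upperUnitriangular (Fin N) K) :
    ∃ k : ℕ, toConjAct ((⟨zpowDiagGL (uniformizer_ne_zero hd.vϖ) (fun i : Fin N => (N : ℤ) - 1 - 2 * (i : ℕ)),
        zpowDiagGL_mem_unitaryGroupOfForm hd.σϖ _ sub_two_mul_rev⟩ :
          unitaryGroupOfForm σ ((StdForm.antidiagonal N).over K)) ^ k) • u ∈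
      unitaryInt σ ((StdForm.antidiagonal N).over K) := by
  have hϖ0 := uniformizer_ne_zero hd.vϖ
  obtain ⟨k, hk⟩ := exists_v_uniformizer_pow_mul_le_one_forall hd.vϖ
    (fun p : (Fin N × Fin N) ⊕ (Fin N × Fin N) => p.elim
      (fun ij => ((u : GL (Fin N) K) : Matrix (Fin N) (Fin N) K) ij.1 ij.2)
      (fun ij => (((u : GL (Fin N) K)⁻¹ : GL (Fin N) K) : Matrix (Fin N) (Fin N) K) ij.1 ij.2))
  refine ⟨k, ?_⟩
  set lam : Fin N → ℤ := fun i => (N : ℤ) - 1 - 2 * (i : ℕ) with hlam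
  have key : ∀ y : GL (Fin N) K, y ∈ upperUnitriangular (Fin N) K →
      (∀ i j : Fin N, ∀ l : ℕ, k ≤ l → Valued.v (ϖ ^ l * (y : Matrix (Fin N) (Fin N) K) i j) ≤ 1) →
      ∀ i j, Valued.v (((zpowDiagGL hϖ0 ((k : ℤ) • lam) * y * (zpowDiagGL hϖ0 ((k : ℤ) • lam))⁻¹ : GL (Fin N) K) :
        Matrix (Fin N) (Fin N) K) i j) ≤ 1 := by
    intro y hy hyO i j
    rw [coe_conj_zpowDiagGL_apply_unitary]
    rcases lt_trichotomy j i with hji | rfl | hij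
    · rw [blockTriangular_of_mem_upperUnitriangular hy hji, mul_zero, map_zero]; exact zero_le
    · rw [sub_self, zpow_zero, one_mul, apply_self_of_mem_upperUnitriangular hy, map_one]
    · have hij' : (i : ℕ) + 1 ≤ (j : ℕ) := hij
      have hexp : ((k : ℤ) • lam) i - ((k : ℤ) • lam) j = ((k * (2 * ((j : ℕ) - (i : ℕ))) : ℕ) : ℤ) := by
        simp only [hlam, Pi.smul_apply, smul_eq_mul]
        push_cast [Nat.cast_sub hij.le]
        ring
      rw [hexp, zpow_natCast]
      exact hyO i j _ (Nat.le_mul_of_pos_right k (by omega))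
  rw [mem_unitaryInt_iff, toConjAct_smul, Subgroup.coe_mul, Subgroup.coe_mul, Subgroup.coe_inv, Subgroup.coe_pow,
    coe_zpowDiagGL_pow_unitary]
  refine ⟨key _ hu (fun i j l hl => hk (Sum.inl (i, j)) l hl), fun i j => ?_⟩
  have e : (zpowDiagGL hϖ0 ((k : ℤ) • lam) * (u : GL (Fin N) K) * (zpowDiagGL hϖ0 ((k : ℤ) • lam))⁻¹)⁻¹ =
      zpowDiagGL hϖ0 ((k : ℤ) • lam) * (u : GL (Fin N) K)⁻¹ * (zpowDiagGL hϖ0 ((k : ℤ) • lam))⁻¹ := by group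
  rw [e]
  exact key _ ((upperUnitriangular (Fin N) K).inv_mem hu) (fun i j l hl => hk (Sum.inr (i, j)) l hl) i j

/-- **THE RELATIVE UNIMODULARITY HYPOTHESIS FOR `U(σ, J₀)`**: every `y ∈ P` with `a y = 0` lies in a subgroup `V ⊇ P ∩ K₀`
with `[V : P ∩ K₀] < ∞`. [cite: CartierCorvallis1979, §I.3, §IV (4.2)] -/
theorem exists_subgroup_relIndex_ne_zero_unitary (hd : UnramifiedLocalConjDatum σ ϖ)
    [IsHeckeTriple (⊤ : Submonoid (unitaryGroupOfForm σ ((StdForm.antidiagonal N).over K)))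
      (unitaryInt σ ((StdForm.antidiagonal N).over K)) (unitaryInt σ ((StdForm.antidiagonal N).over K))] :
    ∀ y ∈ hd.borelLatticeU, hd.iwasawaExp y = 0 →
      ∃ V : Subgroup (unitaryGroupOfForm σ ((StdForm.antidiagonal N).over K)), y ∈ V ∧
        hd.borelLatticeU ⊓ unitaryInt σ ((StdForm.antidiagonal N).over K) ≤ V ∧
        (hd.borelLatticeU ⊓ unitaryInt σ ((StdForm.antidiagonal N).over K)).relIndex V ≠ 0 := by
  refine IsIwasawaExponent.exists_subgroup_relIndex_ne_zero_of_contracting (a := hd.iwasawaExp)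
    (t := (⟨zpowDiagGL (uniformizer_ne_zero hd.vϖ) (fun i : Fin N => (N : ℤ) - 1 - 2 * (i : ℕ)),
        zpowDiagGL_mem_unitaryGroupOfForm hd.σϖ _ sub_two_mul_rev⟩ :
          unitaryGroupOfForm σ ((StdForm.antidiagonal N).over K))) ?_
    (hd.conjAct_smul_inf_le_of_antitone_unitary antitone_sub_two_mul sub_two_mul_rev)
    fun y hy hay => hd.exists_conj_pow_mem_unitaryInt (hd.coe_mem_upperUnitriangular_of_iwasawaExp_eq_zero hy hay)
  exact hd.zpowDiagGL_mem_borelLatticeU sub_two_mul_rev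

/-! ## §2 Every double coset of `(U(σ, J₀), K₀)` is self-inverse -/

/-- **`K₀ g⁻¹ K₀ = K₀ g K₀`** for every `g ∈ U(σ, J₀)` (`-1 ∈ W`: the Cartan representative `t = diag(ϖ^c)` of `g` satisfies
`t⁻¹ ∈ K₀ t K₀`). [cite: BruhatTits1972, (4.4.3)] [cite: Tits1979, §3.3.3] -/
theorem orbit_inv_eq_orbit_unitary (hd : UnramifiedLocalConjDatum σ ϖ) (g : unitaryGroupOfForm σ ((StdForm.antidiagonal N).over K)) :
    MulAction.orbit (unitaryInt σ ((StdForm.antidiagonal N).over K))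
        ((g⁻¹ : unitaryGroupOfForm σ ((StdForm.antidiagonal N).over K)) :
          unitaryGroupOfForm σ ((StdForm.antidiagonal N).over K) ⧸ unitaryInt σ ((StdForm.antidiagonal N).over K)) =
      MulAction.orbit (unitaryInt σ ((StdForm.antidiagonal N).over K))
        (g : unitaryGroupOfForm σ ((StdForm.antidiagonal N).over K) ⧸ unitaryInt σ ((StdForm.antidiagonal N).over K)) := by
  obtain ⟨t, ⟨c, -, hc, ht⟩, htorb⟩ := hd.exists_zpowDiagGL_monotone_mem_orbit_unitary
    (g : unitaryGroupOfForm σ ((StdForm.antidiagonal N).over K) ⧸ unitaryInt σ ((StdForm.antidiagonal N).over K))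
  have hteq : t = ⟨zpowDiagGL (uniformizer_ne_zero hd.vϖ) c, zpowDiagGL_mem_unitaryGroupOfForm hd.σϖ _ hc⟩ := Subtype.ext ht
  -- `g ∈ K₀ t K₀`
  obtain ⟨A, hA, B, hB, hAB⟩ := (heckeAlgebra.coe_mem_orbit_coe_iff _ _ _).1 htorb
  -- `t = A g B`, so `g⁻¹ = B t⁻¹ A` and `t⁻¹ ∈ K₀ t K₀`
  have htinv := hd.inv_zpowDiagGL_mem_orbit_unitary hc
  rw [← hteq] at htinv
  obtain ⟨A', hA', B', hB', hAB'⟩ := (heckeAlgebra.coe_mem_orbit_coe_iff _ _ _).1 htinv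
  rw [MulAction.orbit_eq_iff, heckeAlgebra.coe_mem_orbit_coe_iff]
  -- `g⁻¹ = B t⁻¹ A = B (A' t B') A = (B A') (A g B) (B' A)`
  refine ⟨B * A' * A, (unitaryInt σ _).mul_mem ((unitaryInt σ _).mul_mem hB hA') hA, B * B' * A,
    (unitaryInt σ _).mul_mem ((unitaryInt σ _).mul_mem hB hB') hA, ?_⟩
  have e1 : g⁻¹ = B * t⁻¹ * A := by rw [hAB]; group
  rw [e1, hAB', hAB]
  group

section SelfInverse

variable [IsHeckeTriple (⊤ : Submonoid (unitaryGroupOfForm σ ((StdForm.antidiagonal N).over K)))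
  (unitaryInt σ ((StdForm.antidiagonal N).over K)) (unitaryInt σ ((StdForm.antidiagonal N).over K))]

/-- **`T_{g⁻¹} = T_g` in `ℋ(U(σ, J₀), K₀; R)`** for every `g`. [cite: BruhatTits1972, (4.4.3)] [cite: CartierCorvallis1979, §IV Thm. 4.1] -/
theorem doubleCosetOperator_inv_unitary {R : Type*} [CommRing R] (hd : UnramifiedLocalConjDatum σ ϖ)
    (g : unitaryGroupOfForm σ ((StdForm.antidiagonal N).over K)) :
    heckeAlgebra.doubleCosetOperator (k := R) (unitaryInt σ ((StdForm.antidiagonal N).over K)) g⁻¹ =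
      heckeAlgebra.doubleCosetOperator (k := R) (unitaryInt σ ((StdForm.antidiagonal N).over K)) g :=
  heckeAlgebra.doubleCosetOperator_eq_of_orbit_eq _ (hd.orbit_inv_eq_orbit_unitary g)

end SelfInverse

/-! ## §3 The `w₀`-symmetry of the Satake transforms of `U(σ, J₀)` -/

section Duality

variable {R : Type*} [CommRing R]
  [IsHeckeTriple (⊤ : Submonoid (unitaryGroupOfForm σ ((StdForm.antidiagonal N).over K)))
    (unitaryInt σ ((StdForm.antidiagonal N).over K)) (unitaryInt σ ((StdForm.antidiagonal N).over K))]

/-- **DUALITY FOR `U(σ, J₀)` (counting version)**: for `μ` antisymmetric and every `g`,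
`#{γ ∈ K₀gK₀/K₀ : a γ = μ} · [t_μK_Pt_μ⁻¹ : K_P ∩ t_μK_Pt_μ⁻¹] = #{γ ∈ K₀gK₀/K₀ : a γ = -μ} · [K_P : K_P ∩ t_μK_Pt_μ⁻¹]`
(`t_μ = diag(ϖ^μ)`, `K_P = P ∩ K₀`; the double coset of `g⁻¹` is that of `g`).
[cite: CartierCorvallis1979, §IV (4.2), Thm. 4.1] [cite: Laumon1995, (4.1.4)–(4.1.6)] -/
theorem card_filter_iwasawaExp_mul_relIndex_eq_unitary (hd : UnramifiedLocalConjDatum σ ϖ)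
    (g : unitaryGroupOfForm σ ((StdForm.antidiagonal N).over K)) {μ : Fin N → ℤ} (hμ : ∀ i, μ (Fin.rev i) = -μ i)
    [DecidablePred fun α : unitaryGroupOfForm σ ((StdForm.antidiagonal N).over K) ⧸ unitaryInt σ ((StdForm.antidiagonal N).over K) =>
      hd.iwasawaExp α.out = μ]
    [DecidablePred fun α : unitaryGroupOfForm σ ((StdForm.antidiagonal N).over K) ⧸ unitaryInt σ ((StdForm.antidiagonal N).over K) =>
      hd.iwasawaExp α.out = -μ] :
    ((finite_orbit_quotient (unitaryInt σ ((StdForm.antidiagonal N).over K)) g).toFinset.filter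
          (fun α => hd.iwasawaExp α.out = μ)).card *
        (hd.borelLatticeU ⊓ unitaryInt σ ((StdForm.antidiagonal N).over K)).relIndex
          (toConjAct (⟨zpowDiagGL (uniformizer_ne_zero hd.vϖ) μ, zpowDiagGL_mem_unitaryGroupOfForm hd.σϖ _ hμ⟩ :
              unitaryGroupOfForm σ ((StdForm.antidiagonal N).over K)) •
            (hd.borelLatticeU ⊓ unitaryInt σ ((StdForm.antidiagonal N).over K))) =
      ((finite_orbit_quotient (unitaryInt σ ((StdForm.antidiagonal N).over K)) g).toFinset.filter
          (fun α => hd.iwasawaExp α.out = -μ)).card *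
        (toConjAct (⟨zpowDiagGL (uniformizer_ne_zero hd.vϖ) μ, zpowDiagGL_mem_unitaryGroupOfForm hd.σϖ _ hμ⟩ :
              unitaryGroupOfForm σ ((StdForm.antidiagonal N).over K)) •
            (hd.borelLatticeU ⊓ unitaryInt σ ((StdForm.antidiagonal N).over K))).relIndex
          (hd.borelLatticeU ⊓ unitaryInt σ ((StdForm.antidiagonal N).over K)) := by
  classical
  have ha := hd.iwasawaExp_zpowDiagGL hμ
  have key := (hd.isIwasawaExponent (N := N)).card_filter_mul_relIndex_eq hd.exists_subgroup_relIndex_ne_zero_unitary g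
    (hd.zpowDiagGL_mem_borelLatticeU hμ)
  simp only [ha] at key
  -- the double coset of `g⁻¹` is that of `g`
  have horb : (finite_orbit_quotient (unitaryInt σ ((StdForm.antidiagonal N).over K)) g⁻¹).toFinset =
      (finite_orbit_quotient (unitaryInt σ ((StdForm.antidiagonal N).over K)) g).toFinset := by
    ext γ
    rw [Set.Finite.mem_toFinset, Set.Finite.mem_toFinset, hd.orbit_inv_eq_orbit_unitary g]
  rw [horb] at key
  convert key using 2

/-- **THE `w₀`-SYMMETRY OF THE COUNTING TRANSFORM OF EVERY HECKE OPERATOR ON `U(σ, J₀)`**: for every commutative ring `R`,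
every `T ∈ ℋ(U(σ, J₀), K₀; R)` and every antisymmetric `μ`,
`𝒮_1(T)_μ · [t_μK_Pt_μ⁻¹ : K_P ∩ t_μK_Pt_μ⁻¹] = 𝒮_1(T)_{-μ} · [K_P : K_P ∩ t_μK_Pt_μ⁻¹]`.
[cite: CartierCorvallis1979, §IV Thm. 4.1] [cite: Minguez2011, §4] -/
theorem coeff_satakeTransform_one_mul_relIndex_eq_unitary (hd : UnramifiedLocalConjDatum σ ϖ)
    (T : heckeAlgebra R (unitaryGroupOfForm σ ((StdForm.antidiagonal N).over K)) (unitaryInt σ ((StdForm.antidiagonal N).over K)))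
    {μ : Fin N → ℤ} (hμ : ∀ i, μ (Fin.rev i) = -μ i) :
    ((hd.isIwasawaExponent (N := N)).satakeTransform (1 : Multiplicative (Fin N → ℤ) →* R) T).coeff μ *
        (((hd.borelLatticeU ⊓ unitaryInt σ ((StdForm.antidiagonal N).over K)).relIndex
          (toConjAct (⟨zpowDiagGL (uniformizer_ne_zero hd.vϖ) μ, zpowDiagGL_mem_unitaryGroupOfForm hd.σϖ _ hμ⟩ :
              unitaryGroupOfForm σ ((StdForm.antidiagonal N).over K)) •
            (hd.borelLatticeU ⊓ unitaryInt σ ((StdForm.antidiagonal N).over K))) : ℕ) : R) =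
      ((hd.isIwasawaExponent (N := N)).satakeTransform (1 : Multiplicative (Fin N → ℤ) →* R) T).coeff (-μ) *
        (((toConjAct (⟨zpowDiagGL (uniformizer_ne_zero hd.vϖ) μ, zpowDiagGL_mem_unitaryGroupOfForm hd.σϖ _ hμ⟩ :
              unitaryGroupOfForm σ ((StdForm.antidiagonal N).over K)) •
            (hd.borelLatticeU ⊓ unitaryInt σ ((StdForm.antidiagonal N).over K))).relIndex
          (hd.borelLatticeU ⊓ unitaryInt σ ((StdForm.antidiagonal N).over K)) : ℕ) : R) := by
  have key := (hd.isIwasawaExponent (N := N)).coeff_satakeTransform_one_mul_relIndex_eq_of_forall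
    hd.exists_subgroup_relIndex_ne_zero_unitary (fun g => hd.doubleCosetOperator_inv_unitary (R := R) g)
    (hd.zpowDiagGL_mem_borelLatticeU hμ) T
  rw [hd.iwasawaExp_zpowDiagGL hμ] at key
  exact key

/-- **Dominant exponents**: for `μ` antitone antisymmetric, `t_μ` contracts `K_P` and the first index is `1`, so
`𝒮_1(T)_μ = 𝒮_1(T)_{-μ} · [K_P : t_μ K_P t_μ⁻¹]` — the coefficient at `x^μ` is the MODULUS `δ(μ) = [K_P : t_μK_Pt_μ⁻¹]` times
the coefficient at `x^{-μ}`, for every `T`. [cite: CartierCorvallis1979, §IV Thm. 4.1] [cite: Laumon1995, (4.1.4)] -/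
theorem coeff_satakeTransform_one_eq_relIndex_mul_of_antitone_unitary (hd : UnramifiedLocalConjDatum σ ϖ)
    (T : heckeAlgebra R (unitaryGroupOfForm σ ((StdForm.antidiagonal N).over K)) (unitaryInt σ ((StdForm.antidiagonal N).over K)))
    {μ : Fin N → ℤ} (hμa : Antitone μ) (hμ : ∀ i, μ (Fin.rev i) = -μ i) :
    ((hd.isIwasawaExponent (N := N)).satakeTransform (1 : Multiplicative (Fin N → ℤ) →* R) T).coeff μ =
      ((hd.isIwasawaExponent (N := N)).satakeTransform (1 : Multiplicative (Fin N → ℤ) →* R) T).coeff (-μ) *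
        (((toConjAct (⟨zpowDiagGL (uniformizer_ne_zero hd.vϖ) μ, zpowDiagGL_mem_unitaryGroupOfForm hd.σϖ _ hμ⟩ :
              unitaryGroupOfForm σ ((StdForm.antidiagonal N).over K)) •
            (hd.borelLatticeU ⊓ unitaryInt σ ((StdForm.antidiagonal N).over K))).relIndex
          (hd.borelLatticeU ⊓ unitaryInt σ ((StdForm.antidiagonal N).over K)) : ℕ) : R) := by
  have h := hd.coeff_satakeTransform_one_mul_relIndex_eq_unitary (R := R) T hμ
  rwa [Subgroup.relIndex_eq_one.2 (hd.conjAct_smul_inf_le_of_antitone_unitary hμa hμ), Nat.cast_one, mul_one] at h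

/-- The symmetry for ANY weight `w`: `𝒮_w(T)_μ · w(-μ) · [t_μK_Pt_μ⁻¹ : K_P ∩ t_μK_Pt_μ⁻¹] =
𝒮_w(T)_{-μ} · w(μ) · [K_P : K_P ∩ t_μK_Pt_μ⁻¹]`. [cite: CartierCorvallis1979, §IV Thm. 4.1] -/
theorem coeff_satakeTransform_mul_relIndex_eq_unitary (hd : UnramifiedLocalConjDatum σ ϖ) (w : Multiplicative (Fin N → ℤ) →* R)
    (T : heckeAlgebra R (unitaryGroupOfForm σ ((StdForm.antidiagonal N).over K)) (unitaryInt σ ((StdForm.antidiagonal N).over K)))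
    {μ : Fin N → ℤ} (hμ : ∀ i, μ (Fin.rev i) = -μ i) :
    ((hd.isIwasawaExponent (N := N)).satakeTransform w T).coeff μ * w (Multiplicative.ofAdd (-μ)) *
        (((hd.borelLatticeU ⊓ unitaryInt σ ((StdForm.antidiagonal N).over K)).relIndex
          (toConjAct (⟨zpowDiagGL (uniformizer_ne_zero hd.vϖ) μ, zpowDiagGL_mem_unitaryGroupOfForm hd.σϖ _ hμ⟩ :
              unitaryGroupOfForm σ ((StdForm.antidiagonal N).over K)) •
            (hd.borelLatticeU ⊓ unitaryInt σ ((StdForm.antidiagonal N).over K))) : ℕ) : R) =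
      ((hd.isIwasawaExponent (N := N)).satakeTransform w T).coeff (-μ) * w (Multiplicative.ofAdd μ) *
        (((toConjAct (⟨zpowDiagGL (uniformizer_ne_zero hd.vϖ) μ, zpowDiagGL_mem_unitaryGroupOfForm hd.σϖ _ hμ⟩ :
              unitaryGroupOfForm σ ((StdForm.antidiagonal N).over K)) •
            (hd.borelLatticeU ⊓ unitaryInt σ ((StdForm.antidiagonal N).over K))).relIndex
          (hd.borelLatticeU ⊓ unitaryInt σ ((StdForm.antidiagonal N).over K)) : ℕ) : R) := by
  have key := (hd.isIwasawaExponent (N := N)).coeff_satakeTransform_mul_relIndex_eq_of_forall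
    hd.exists_subgroup_relIndex_ne_zero_unitary (fun g => hd.doubleCosetOperator_inv_unitary (R := R) g) w
    (hd.zpowDiagGL_mem_borelLatticeU hμ) T
  rw [hd.iwasawaExp_zpowDiagGL hμ] at key
  exact key

/-- **`𝒮_w(T) = ι(𝒮_{w'}(T))` for every `T ∈ ℋ(U(σ, J₀), K₀; R)`**, `ι(x^μ) = x^{-μ}`, for weights `w, w'` absorbing the
modulus (`[K_P : K_P ∩ tK_Pt⁻¹] · w(a t) = [tK_Pt⁻¹ : K_P ∩ tK_Pt⁻¹] · w'(-a t)` on `P`, the former indices non-zero-divisors in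
`R`; e.g. `w = w' = δ^{-1/2}` when `√q ∈ Rˣ`). [cite: CartierCorvallis1979, §IV Thm. 4.1] [cite: Minguez2011, §4] -/
theorem satakeTransform_eq_domCongr_neg_unitary (hd : UnramifiedLocalConjDatum σ ϖ) (w w' : Multiplicative (Fin N → ℤ) →* R)
    (hw : ∀ t : unitaryGroupOfForm σ ((StdForm.antidiagonal N).over K), t ∈ hd.borelLatticeU →
      (((toConjAct t • (hd.borelLatticeU ⊓ unitaryInt σ ((StdForm.antidiagonal N).over K))).relIndex
          (hd.borelLatticeU ⊓ unitaryInt σ ((StdForm.antidiagonal N).over K)) : ℕ) : R) * w (Multiplicative.ofAdd (hd.iwasawaExp t)) =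
        (((hd.borelLatticeU ⊓ unitaryInt σ ((StdForm.antidiagonal N).over K)).relIndex
          (toConjAct t • (hd.borelLatticeU ⊓ unitaryInt σ ((StdForm.antidiagonal N).over K))) : ℕ) : R) *
          w' (Multiplicative.ofAdd (-hd.iwasawaExp t)))
    (hreg : ∀ t : unitaryGroupOfForm σ ((StdForm.antidiagonal N).over K), t ∈ hd.borelLatticeU →
      (((toConjAct t • (hd.borelLatticeU ⊓ unitaryInt σ ((StdForm.antidiagonal N).over K))).relIndex
          (hd.borelLatticeU ⊓ unitaryInt σ ((StdForm.antidiagonal N).over K)) : ℕ) : R) ∈ nonZeroDivisors R)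
    (T : heckeAlgebra R (unitaryGroupOfForm σ ((StdForm.antidiagonal N).over K)) (unitaryInt σ ((StdForm.antidiagonal N).over K))) :
    (hd.isIwasawaExponent (N := N)).satakeTransform w T =
      AddMonoidAlgebra.domCongr R R (AddEquiv.neg (Fin N → ℤ)) ((hd.isIwasawaExponent (N := N)).satakeTransform w' T) :=
  (hd.isIwasawaExponent (N := N)).satakeTransform_eq_domCongr_neg_of_forall hd.exists_subgroup_relIndex_ne_zero_unitary w w' hw
    hreg (fun g => hd.doubleCosetOperator_inv_unitary (R := R) g) T

/-- With one symmetric weight `w = w'`: **every Satake transform of `U(σ, J₀)` is `ι`-invariant.**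
[cite: CartierCorvallis1979, §IV Thm. 4.1] [cite: Minguez2011, §4] -/
theorem domCongr_neg_satakeTransform_eq_self_unitary (hd : UnramifiedLocalConjDatum σ ϖ) (w : Multiplicative (Fin N → ℤ) →* R)
    (hw : ∀ t : unitaryGroupOfForm σ ((StdForm.antidiagonal N).over K), t ∈ hd.borelLatticeU →
      (((toConjAct t • (hd.borelLatticeU ⊓ unitaryInt σ ((StdForm.antidiagonal N).over K))).relIndex
          (hd.borelLatticeU ⊓ unitaryInt σ ((StdForm.antidiagonal N).over K)) : ℕ) : R) * w (Multiplicative.ofAdd (hd.iwasawaExp t)) =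
        (((hd.borelLatticeU ⊓ unitaryInt σ ((StdForm.antidiagonal N).over K)).relIndex
          (toConjAct t • (hd.borelLatticeU ⊓ unitaryInt σ ((StdForm.antidiagonal N).over K))) : ℕ) : R) *
          w (Multiplicative.ofAdd (-hd.iwasawaExp t)))
    (hreg : ∀ t : unitaryGroupOfForm σ ((StdForm.antidiagonal N).over K), t ∈ hd.borelLatticeU →
      (((toConjAct t • (hd.borelLatticeU ⊓ unitaryInt σ ((StdForm.antidiagonal N).over K))).relIndex
          (hd.borelLatticeU ⊓ unitaryInt σ ((StdForm.antidiagonal N).over K)) : ℕ) : R) ∈ nonZeroDivisors R)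
    (T : heckeAlgebra R (unitaryGroupOfForm σ ((StdForm.antidiagonal N).over K)) (unitaryInt σ ((StdForm.antidiagonal N).over K))) :
    AddMonoidAlgebra.domCongr R R (AddEquiv.neg (Fin N → ℤ)) ((hd.isIwasawaExponent (N := N)).satakeTransform w T) =
      (hd.isIwasawaExponent (N := N)).satakeTransform w T :=
  (hd.satakeTransform_eq_domCongr_neg_unitary w w hw hreg T).symm

omit [IsHeckeTriple (⊤ : Submonoid (unitaryGroupOfForm σ ((StdForm.antidiagonal N).over K)))
    (unitaryInt σ ((StdForm.antidiagonal N).over K)) (unitaryInt σ ((StdForm.antidiagonal N).over K))] in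
/-- **Antidominant torus elements EXPAND `K_P`**: for `c` monotone antisymmetric, `K_P ≤ t_c K_P t_c⁻¹`
(`t_{-c} = t_c⁻¹` contracts). [cite: BruhatTits1972, (4.4.4) (ii)] -/
theorem inf_le_conjAct_smul_of_monotone_unitary (hd : UnramifiedLocalConjDatum σ ϖ) {c : Fin N → ℤ} (hc : Monotone c)
    (hc' : ∀ i, c (Fin.rev i) = -c i) :
    hd.borelLatticeU ⊓ unitaryInt σ ((StdForm.antidiagonal N).over K) ≤
      toConjAct (⟨zpowDiagGL (uniformizer_ne_zero hd.vϖ) c, zpowDiagGL_mem_unitaryGroupOfForm hd.σϖ _ hc'⟩ :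
          unitaryGroupOfForm σ ((StdForm.antidiagonal N).over K)) •
        (hd.borelLatticeU ⊓ unitaryInt σ ((StdForm.antidiagonal N).over K)) := by
  have hneg : ∀ i, (-c) (Fin.rev i) = -(-c) i := fun i => by simp only [Pi.neg_apply, hc' i]
  have h := hd.conjAct_smul_inf_le_of_antitone_unitary (lam := -c) hc.neg hneg
  have e : (⟨zpowDiagGL (uniformizer_ne_zero hd.vϖ) (-c), zpowDiagGL_mem_unitaryGroupOfForm hd.σϖ _ hneg⟩ :
        unitaryGroupOfForm σ ((StdForm.antidiagonal N).over K)) =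
      (⟨zpowDiagGL (uniformizer_ne_zero hd.vϖ) c, zpowDiagGL_mem_unitaryGroupOfForm hd.σϖ _ hc'⟩ :
        unitaryGroupOfForm σ ((StdForm.antidiagonal N).over K))⁻¹ :=
    Subtype.ext (show zpowDiagGL (uniformizer_ne_zero hd.vϖ) (-c) = (zpowDiagGL (uniformizer_ne_zero hd.vϖ) c)⁻¹ from
      zpowDiagGL_neg _ c)
  rw [e, toConjAct_inv] at h
  have h' := Subgroup.pointwise_smul_le_pointwise_smul_iff
    (a := toConjAct (⟨zpowDiagGL (uniformizer_ne_zero hd.vϖ) c, zpowDiagGL_mem_unitaryGroupOfForm hd.σϖ _ hc'⟩ :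
      unitaryGroupOfForm σ ((StdForm.antidiagonal N).over K))) |>.2 h
  rwa [smul_inv_smul] at h'

/-- **The dominant-extreme count of `K₀ t_c K₀` is the modulus index**: for `c` monotone antisymmetric,
`#{γ ∈ K₀ t_c K₀ / K₀ : a γ = -c} = [t_c K_P t_c⁻¹ : K_P]` — by duality from the tree's `#{γ : a γ = c} = 1`
(Bruhat–Tits (4.4.4) (ii)). [cite: BruhatTits1972, Prop. (4.4.4) (ii)] [cite: CartierCorvallis1979, §IV (4.2)] -/
theorem card_filter_iwasawaExp_orbit_neg_eq_relIndex_unitary (hd : UnramifiedLocalConjDatum σ ϖ) {c : Fin N → ℤ}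
    (hc : Monotone c) (hc' : ∀ i, c (Fin.rev i) = -c i)
    [DecidablePred fun α : unitaryGroupOfForm σ ((StdForm.antidiagonal N).over K) ⧸ unitaryInt σ ((StdForm.antidiagonal N).over K) =>
      hd.iwasawaExp α.out = -c] :
    ((finite_orbit_quotient (unitaryInt σ ((StdForm.antidiagonal N).over K))
        (⟨zpowDiagGL (uniformizer_ne_zero hd.vϖ) c, zpowDiagGL_mem_unitaryGroupOfForm hd.σϖ _ hc'⟩ :
          unitaryGroupOfForm σ ((StdForm.antidiagonal N).over K))).toFinset.filter
          (fun α => hd.iwasawaExp α.out = -c)).card =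
      (hd.borelLatticeU ⊓ unitaryInt σ ((StdForm.antidiagonal N).over K)).relIndex
        (toConjAct (⟨zpowDiagGL (uniformizer_ne_zero hd.vϖ) c, zpowDiagGL_mem_unitaryGroupOfForm hd.σϖ _ hc'⟩ :
            unitaryGroupOfForm σ ((StdForm.antidiagonal N).over K)) •
          (hd.borelLatticeU ⊓ unitaryInt σ ((StdForm.antidiagonal N).over K))) := by
  classical
  have h := hd.card_filter_iwasawaExp_mul_relIndex_eq_unitary
    (⟨zpowDiagGL (uniformizer_ne_zero hd.vϖ) c, zpowDiagGL_mem_unitaryGroupOfForm hd.σϖ _ hc'⟩ :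
      unitaryGroupOfForm σ ((StdForm.antidiagonal N).over K)) hc'
  rw [hd.card_filter_iwasawaExp_orbit_eq_one_unitary ⟨hc, hc'⟩ rfl, one_mul,
    Subgroup.relIndex_eq_one.2 (hd.inf_le_conjAct_smul_of_monotone_unitary hc hc'), mul_one] at h
  convert h.symm using 2

end Duality

end UnramifiedLocalConjDatum

end Literature.NumberTheory.Automorphic.HermitianLattice

end
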